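import Mathlib
import Summits.AtomisticToContinuum.HydrodynamicLimit.Theorems.ImplosionDichotomyDenseExcursionPackingAnalyticDefs

/-!
# Analyticity of the hard-sphere stiffening law near zero packing
# (crux `DenseExcursion`, stmt-AtomisticToContinuum-12586, line `packing-analytic-implosion`)

Helper file (`--supports stmt-AtomisticToContinuum-12586`, line lead a2, stub `stub_analyticPackingImplosion`).
Step (0) of the stub's decomposition (see the worker's report): the stub feeds the excess free energy `F`, ANALYTIC on
`(−η₀, η₀)` (for hard spheres: the virial series, `HsEosLowDensity`), into the stiffening law
`M = stiffening F = Π_F + (3/5) φ Π_F′`, `Π_F = e^{(2/3)F}(1 + φ F′)` of `AnalyticPackingImplosion`; the majorant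
argument for `Γ` needs `M` ANALYTIC at `0` (geometric Taylor coefficients `|m_j| ≤ A ρ^j`). Kernel-checked:
`analyticOnNhd_isentropePressureFactor`, `analyticOnNhd_stiffening` (REGISTERED helper) — analytic functions are
closed under `deriv` (`AnalyticOnNhd.deriv`), products, sums and `Real.exp ∘ ·`. NOT here: anything about `Γ`.
-/

noncomputable section

open Set

namespace Summit.AtomisticToContinuum.HydrodynamicLimit.Theorems.PackingAnalyticImplosion

/-- The isentrope pressure factor `Π_F = e^{(2/3)F}(1 + φF′)` of an analytic free energy is analytic. [folklore] -/
theorem analyticOnNhd_isentropePressureFactor {F : ℝ → ℝ} {s : Set ℝ} (hF : AnalyticOnNhd ℝ F s) :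
    AnalyticOnNhd ℝ (isentropePressureFactor F) s := by
  have h1 : AnalyticOnNhd ℝ (fun φ => Real.exp (2 / 3 * F φ)) s := (analyticOnNhd_const.mul hF).rexp
  have h2 : AnalyticOnNhd ℝ (fun φ => 1 + φ * deriv F φ) s :=
    analyticOnNhd_const.add (analyticOnNhd_id.mul hF.deriv)
  exact h1.mul h2

/-- **The stiffening law of an analytic free energy is analytic** (registered helper `analyticOnNhd_stiffening`):
`M_F = Π_F + (3/5) φ Π_F′` is analytic wherever `F` is; in the stub, on `(−η₀, η₀) ∋ 0`. [folklore] -/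
theorem analyticOnNhd_stiffening :
    ∀ (F : ℝ → ℝ) (η₀ : ℝ), AnalyticOnNhd ℝ F (Set.Ioo (-η₀) η₀) →
      AnalyticOnNhd ℝ (stiffening F) (Set.Ioo (-η₀) η₀) := by
  intro F η₀ hF
  have hP := analyticOnNhd_isentropePressureFactor hF
  have h2 : AnalyticOnNhd ℝ (fun φ => 3 / 5 * φ * deriv (isentropePressureFactor F) φ) (Set.Ioo (-η₀) η₀) :=
    (analyticOnNhd_const.mul analyticOnNhd_id).mul hP.deriv
  exact hP.add h2

/-- In the stub's setting (`F` analytic on `(−η₀, η₀)`, `η₀ > 0`, `F 0 = 0`): `M = stiffening F` is analytic at `0`,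
differentiable at `0`, and `M 0 = 1` — the hypotheses under which the landed `order_one_of_analyticPackingImplosion`
reads off `X₁`. [folklore] -/
theorem stiffening_analyticAt_zero {F : ℝ → ℝ} {η₀ : ℝ} (hη₀ : 0 < η₀)
    (hF : AnalyticOnNhd ℝ F (Set.Ioo (-η₀) η₀)) (hF0 : F 0 = 0) :
    AnalyticAt ℝ (stiffening F) 0 ∧ DifferentiableAt ℝ (stiffening F) 0 ∧ stiffening F 0 = 1 := by
  have h0 : (0 : ℝ) ∈ Set.Ioo (-η₀) η₀ := ⟨by linarith, hη₀⟩
  have hA := analyticOnNhd_stiffening F η₀ hF 0 h0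
  exact ⟨hA, hA.differentiableAt, stiffening_zero hF0⟩

end Summit.AtomisticToContinuum.HydrodynamicLimit.Theorems.PackingAnalyticImplosion

end
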